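import Mathlib
import Literature.Probability.RandomPlanarGeometry.ChordalRestrictionMarkov
import HarnessLib

/-!
# The restriction-kernel clause: upward inheritance along an increasing exhaustion

Crux `AxiomsOfLimit` (stmt-CriticalPhenomena-1370), line `registered`, stub
`stub_kernelClauseInheritUp` (lead c5, idea sleeve-inheritance). Theorems only.

The *kernel clause* for a measure `ν` on curve classes at a Dobrushin domain `D'` reads
`P D' T · ν {γ ⊆ D̄'} = ν (T ∩ {γ ⊆ D̄'})` for every measurable `T`, where
`{γ ⊆ D̄'} = CurveClass.rangeSubset (closure D'.carrier)`. This file proves that the clause passes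
UP an increasing exhaustion: if `P` is chordal with the two-sided restriction property, `ν` is
finite, `D_k ⊆ D'` are Dobrushin domains with the marked points of `D'` and increasing carriers,
the clause holds for `ν` at every `D_k`, the events `B_k = {γ ⊆ D̄_k}` exhaust `B = {γ ⊆ D̄'}` up to
a `ν`-null set and `P D' (⋃ B_k) = 1`, then the clause holds for `ν` at `D'`.

Proof (all in `ℝ≥0∞`, no division). Restriction (i) between `D_k ⊆ D'` and the clause at `D_k`
give the cross identity `ν (T ∩ B_k) · P D' (B_k) = P D' (T ∩ B_k) · ν (B_k)`. Apply it to
`T ∩ B_j` for `k ≥ j` and let `k → ∞` (continuity from below, `P D' (B_k) → 1`,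
`ν (B_k) → ν B`): `ν (T ∩ B_j) = P D' (T ∩ B_j) · ν B`. Let `j → ∞`:
`ν (T ∩ B) = P D' T · ν B`, because `⋃ B_j` has full `P D'`-mass and `B ∖ ⋃ B_j` is `ν`-null.

References: G. F. Lawler, O. Schramm, W. Werner, *Conformal restriction: the chordal case* (2003)
§1, §3; W. Werner, *Lectures on two-dimensional critical percolation* (2007) §3.2. All [folklore].
-/

noncomputable section

open MeasureTheory Set Filter
open scoped ENNReal Topology

namespace Summit.CriticalPhenomena.SAWScalingLimit.Theorems.AxiomsOfLimitKernelClause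

open Literature.Probability.RandomPlanarGeometry

namespace InheritUp

/-- **Monotonicity of the event "the curve stays inside `S`"** in the set `S`. [folklore] -/
theorem rangeSubset_mono {S₁ S₂ : Set ℂ} (h : S₁ ⊆ S₂) :
    CurveClass.rangeSubset S₁ ⊆ CurveClass.rangeSubset S₂ :=
  fun _ hc => Set.Subset.trans hc h

/-- **Abstract upward inheritance.** Let `μ` be a probability measure and `ν` a finite measure,
`B : ℕ → Set α` an increasing sequence of measurable subsets of `Bω` with `ν (Bω ∖ ⋃ B k) = 0` and
`μ (⋃ B k) = 1`. If for every `k` and every measurable `T` the cross identity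
`ν (T ∩ B k) · μ (B k) = μ (T ∩ B k) · ν (B k)` holds, then `μ T · ν Bω = ν (T ∩ Bω)` for every
measurable `T` (two passages to the limit by continuity of measure from below). [folklore] -/
theorem clause_of_exhaustion {α : Type*} [MeasurableSpace α] (μ ν : Measure α)
    [IsProbabilityMeasure μ] [IsFiniteMeasure ν] (B : ℕ → Set α) (Bω : Set α)
    (hmono : Monotone B) (hmeas : ∀ k, MeasurableSet (B k)) (hsub : ∀ k, B k ⊆ Bω)
    (hstar : ∀ (k : ℕ) (T : Set α), MeasurableSet T →
      ν (T ∩ B k) * μ (B k) = μ (T ∩ B k) * ν (B k))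
    (hnull : ν (Bω \ ⋃ k, B k) = 0) (hone : μ (⋃ k, B k) = 1)
    (T : Set α) (hT : MeasurableSet T) :
    μ T * ν Bω = ν (T ∩ Bω) := by
  -- the union of the exhaustion has full `ν`-mass in `Bω` and full `μ`-mass
  have hUsub : (⋃ k, B k) ⊆ Bω := iUnion_subset hsub
  have hνU : ν (⋃ k, B k) = ν Bω := measure_eq_measure_of_null_sdiff hUsub hnull
  have hμU : μ (⋃ k, B k)ᶜ = 0 := (prob_compl_eq_zero_iff (MeasurableSet.iUnion hmeas)).2 hone
  -- continuity from below along the exhaustion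
  have hνB : Tendsto (fun k => ν (B k)) atTop (𝓝 (ν Bω)) := by
    rw [← hνU]
    exact tendsto_measure_iUnion_atTop hmono
  have hμB : Tendsto (fun k => μ (B k)) atTop (𝓝 1) := by
    rw [← hone]
    exact tendsto_measure_iUnion_atTop hmono
  -- the clause on `T ∩ B j`, for every `j`: cross identity for `k ≥ j`, then `k → ∞`
  have hj : ∀ j, ν (T ∩ B j) = μ (T ∩ B j) * ν Bω := by
    intro j
    have hl : Tendsto (fun k => ν (T ∩ B j) * μ (B k)) atTop (𝓝 (ν (T ∩ B j) * 1)) :=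
      ENNReal.Tendsto.const_mul hμB (Or.inr (measure_ne_top ν _))
    have hr : Tendsto (fun k => μ (T ∩ B j) * ν (B k)) atTop (𝓝 (μ (T ∩ B j) * ν Bω)) :=
      ENNReal.Tendsto.const_mul hνB (Or.inr (measure_ne_top μ _))
    have hev : (fun k => ν (T ∩ B j) * μ (B k)) =ᶠ[atTop] fun k => μ (T ∩ B j) * ν (B k) :=
      eventually_atTop.2 ⟨j, fun k hjk => by
        have h := hstar k (T ∩ B j) (hT.inter (hmeas j))
        rwa [inter_assoc, inter_eq_left.2 (hmono hjk)] at h⟩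
    have h := tendsto_nhds_unique (hl.congr' hev) hr
    rwa [mul_one] at h
  -- let `j → ∞`
  have hTmono : Monotone fun j => T ∩ B j := fun i j hij => inter_subset_inter_right T (hmono hij)
  have hl : Tendsto (fun j => ν (T ∩ B j)) atTop (𝓝 (ν (⋃ j, T ∩ B j))) :=
    tendsto_measure_iUnion_atTop (μ := ν) hTmono
  have hr : Tendsto (fun j => μ (T ∩ B j) * ν Bω) atTop (𝓝 (μ (⋃ j, T ∩ B j) * ν Bω)) :=
    ENNReal.Tendsto.mul_const (tendsto_measure_iUnion_atTop (μ := μ) hTmono)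
      (Or.inr (measure_ne_top ν _))
  have hlim : ν (⋃ j, T ∩ B j) = μ (⋃ j, T ∩ B j) * ν Bω :=
    tendsto_nhds_unique (hl.congr hj) hr
  rw [← inter_iUnion, measure_inter_conull hμU] at hlim
  rw [← hlim]
  have hsdiff : (T ∩ Bω) \ (T ∩ ⋃ k, B k) ⊆ Bω \ ⋃ k, B k :=
    fun x hx => ⟨hx.1.2, fun h => hx.2 ⟨hx.1.1, h⟩⟩
  exact measure_eq_measure_of_null_sdiff (inter_subset_inter_right T hUsub)
    (measure_mono_null hsdiff hnull)

end InheritUp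

/-- **Upward inheritance of the restriction-kernel clause along an increasing exhaustion.**
Let `P` be chordal with the two-sided restriction property, `ν` a finite measure on curve
classes, `D'` a Dobrushin domain and `D_k ⊆ D'` Dobrushin domains with the marked points of `D'`
and carriers increasing in `k`; write `B_k = {γ ⊆ D̄_k}`, `B = {γ ⊆ D̄'}`. If the kernel clause
`P (D_k) T · ν B_k = ν (T ∩ B_k)` holds for every `k`, `ν (B ∖ ⋃ B_k) = 0` and
`P D' (⋃ B_k) = 1`, then `P D' T · ν B = ν (T ∩ B)` for every measurable `T`. The cross identity
`ν (T ∩ B_k) · P D' (B_k) = P D' (T ∩ B_k) · ν (B_k)` comes from the clause at `D_k` and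
restriction (i) for `D_k ⊆ D'`; then `InheritUp.clause_of_exhaustion`. [folklore] -/
theorem kernelClause_inheritUp {P : ChordalFamily} (hch : P.IsChordal) (hR : P.IsRestriction)
    (ν : Measure (CurveClass ℂ)) [IsFiniteMeasure ν] (D' : DobrushinDomain)
    (Dk : ℕ → DobrushinDomain) (hsub : ∀ k, (Dk k).carrier ⊆ D'.carrier)
    (h0 : ∀ k, (Dk k).pt 0 = D'.pt 0) (h1 : ∀ k, (Dk k).pt 1 = D'.pt 1)
    (hmono : Monotone (fun k => (Dk k).carrier))
    (hK : ∀ (k : ℕ) (T : Set (CurveClass ℂ)), MeasurableSet T →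
      P (Dk k) T * ν (CurveClass.rangeSubset (closure (Dk k).carrier)) =
        ν (T ∩ CurveClass.rangeSubset (closure (Dk k).carrier)))
    (hnull : ν (CurveClass.rangeSubset (closure D'.carrier) \
      ⋃ k, CurveClass.rangeSubset (closure (Dk k).carrier)) = 0)
    (hone : P D' (⋃ k, CurveClass.rangeSubset (closure (Dk k).carrier)) = 1)
    (T : Set (CurveClass ℂ)) (hT : MeasurableSet T) :
    P D' T * ν (CurveClass.rangeSubset (closure D'.carrier)) =
      ν (T ∩ CurveClass.rangeSubset (closure D'.carrier)) := by
  haveI : IsProbabilityMeasure (P D') := (hch D').1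
  -- the cross identity between `ν` and `P D'` on `B_k`
  have hstar : ∀ (k : ℕ) (S : Set (CurveClass ℂ)), MeasurableSet S →
      ν (S ∩ CurveClass.rangeSubset (closure (Dk k).carrier)) *
          P D' (CurveClass.rangeSubset (closure (Dk k).carrier)) =
        P D' (S ∩ CurveClass.rangeSubset (closure (Dk k).carrier)) *
          ν (CurveClass.rangeSubset (closure (Dk k).carrier)) := by
    intro k S hS
    rw [← hK k S hS, ← hR D' (Dk k) (hsub k) (h0 k) (h1 k) S hS, mul_right_comm]
  exact InheritUp.clause_of_exhaustion (P D') ν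
    (fun k => CurveClass.rangeSubset (closure (Dk k).carrier))
    (CurveClass.rangeSubset (closure D'.carrier))
    (fun i j hij => InheritUp.rangeSubset_mono (closure_mono (hmono hij)))
    (fun k => CurveClass.measurableSet_rangeSubset isClosed_closure)
    (fun k => InheritUp.rangeSubset_mono (closure_mono (hsub k)))
    hstar hnull hone T hT

/-! ### Registered sub-goal of crux stmt-CriticalPhenomena-1370 (line `registered`, stub `stub_kernelClauseInheritUp`) -/

/-- **Registered sub-goal `stub_kernelClauseInheritUp`** (crux stmt-CriticalPhenomena-1370, lead c5):
upward inheritance of the restriction-kernel clause along an increasing exhaustion,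
`kernelClause_inheritUp`, notation-free. [folklore] -/
theorem stub_kernelClauseInheritUp : ∀ (P : Literature.Probability.RandomPlanarGeometry.ChordalFamily), P.IsChordal → P.IsRestriction → ∀ (ν : MeasureTheory.Measure (Literature.Probability.RandomPlanarGeometry.CurveClass ℂ)) [MeasureTheory.IsFiniteMeasure ν] (D' : Literature.Probability.RandomPlanarGeometry.DobrushinDomain) (Dk : ℕ → Literature.Probability.RandomPlanarGeometry.DobrushinDomain), (∀ k, (Dk k).carrier ⊆ D'.carrier) → (∀ k, (Dk k).pt 0 = D'.pt 0) → (∀ k, (Dk k).pt 1 = D'.pt 1) → Monotone (fun k => (Dk k).carrier) → (∀ (k : ℕ) (T : Set (Literature.Probability.RandomPlanarGeometry.CurveClass ℂ)), MeasurableSet T → P (Dk k) T * ν (Literature.Probability.RandomPlanarGeometry.CurveClass.rangeSubset (closure (Dk k).carrier)) = ν (T ∩ Literature.Probability.RandomPlanarGeometry.CurveClass.rangeSubset (closure (Dk k).carrier))) → ν (Literature.Probability.RandomPlanarGeometry.CurveClass.rangeSubset (closure D'.carrier) \ ⋃ k, Literature.Probability.RandomPlanarGeometry.CurveClass.rangeSubset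 (closure (Dk k).carrier)) = 0 → P D' (⋃ k, Literature.Probability.RandomPlanarGeometry.CurveClass.rangeSubset (closure (Dk k).carrier)) = 1 → ∀ T : Set (Literature.Probability.RandomPlanarGeometry.CurveClass ℂ), MeasurableSet T → P D' T * ν (Literature.Probability.RandomPlanarGeometry.CurveClass.rangeSubset (closure D'.carrier)) = ν (T ∩ Literature.Probability.RandomPlanarGeometry.CurveClass.rangeSubset (closure D'.carrier)) := by
  intro P hch hR ν _ D' Dk hsub h0 h1 hmono hK hnull hone T hT
  exact kernelClause_inheritUp hch hR ν D' Dk hsub h0 h1 hmono hK hnull hone T hT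

end Summit.CriticalPhenomena.SAWScalingLimit.Theorems.AxiomsOfLimitKernelClause

end
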